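/-
Copyright: public-domain mathematics; typed transcription for the H21 Literature library (cell lit-balaban,
reader/typer seat r02 gen 5 = literature-prover-lit-balaban-r02-g5-0).

statement-level skeleton of published theorems with citation tags; proofs where landed; nothing here is a claim about the Yang–Mills mass gap

# Bałaban, *Propagators and renormalization transformations for lattice gauge theories. I*,
# Commun. Math. Phys. **95** (1984) 17–40 — the SITE BRIDGE between the two presentations of the tori of Prop. 1.2:
# the tower `Site P j = (ℤ/2L^{m+K−j})^d` (G′, G₀ side: `B5GpSettingTorus`, `B5Eq133G0Torus`) and the product tori
# `Tor (fine n M)`, `Tor M` (G side: `B5Prop12FieldsLattice.latticeSettingP12`)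

[cite: Balaban1984PropagatorsI]  T. Bałaban, Commun. Math. Phys. 95 (1984) 17–40.  p. 18 (1.6) (PDF p. 2): the blocks `B^k(y)`,
`y ∈ T_1^{(k)}`, `x ∈ T_η`, `η = L^{−k}`; p. 35 (PDF p. 19): «T_η … ε = L^{−K}», the cubes `Δ̃(y)`, the distance `|y − y′|`;
p. 39 (PDF p. 23): (1.132)/(1.133) relate `G`, `G₀`, `G′_k` ON THE SAME LATTICE `T_η` — whence a bridge between the two typed
presentations of that lattice is needed by the carriers `B5Transfer132`/`B5Transfer133.Carrier133` (maps `σ`, `ι`, `κ`).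

WHAT THIS MODULE ADDS (SKELETON row B5.Prop1.2, owner's census (vii); requested by seat p37 g6, HOME/STATUS 2026-08-21T09:04:22Z).
GEOMETRY ONLY (sites, corner map, blocks, distances, cubes); sources/norms/operators are bridged elsewhere.
* §1 `nP P = L^K` (fine steps per unit), `MP P = (2L^m, …, 2L^m)` (unit cubes per direction); the numerical identities
  `sitesPerDir 0 = nP·MP_μ`, `sitesPerDir K = MP_μ`; the val-preserving, additive bijections **`eFine P : Site P 0 ≃ Tor (fine nP MP)`**,
  **`eUnit P : Site P K ≃ Tor MP`** (`ZMod.ringEquivCongr` coordinatewise);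
* §2 corner map and blocks: `eFine (B5Ineq137Torus.fine P K y) = toFine nP MP (eUnit y)`, `eUnit (blk P K p) = B5Blocks16.blockOf nP MP (eFine p)`;
* §3 distances: `T P 0 x x′ = distSite (fine nP MP) (eFine x) (eFine x′) = nP · distU (eFine x) (eFine x′)`,
  `T P K y y′ = distSite MP (eUnit y) (eUnit y′)`, `distX P K = distU ∘ eFine`;
* §4 cubes: `inCube P K x y ↔ eFine x ∈ cubeT nP MP (eUnit y)`; and `2 ≤ MP_μ` (the hypothesis of `globCoverP12`).

HONEST SCOPE.  Bookkeeping between two typings of the same finite torus; nothing analytic.  [cite: Balaban1984PropagatorsI, p.35]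
-/
import Mathlib
import Literature.MathematicalPhysics.QuantumFieldTheory.Balaban1983to89.B5GpSettingTorus
import Literature.MathematicalPhysics.QuantumFieldTheory.Balaban1983to89.B5RowSumsP12Lattice

open scoped BigOperators Real
open Finset

namespace Literature.MathematicalPhysics.QuantumFieldTheory.Balaban1983to89.B5SiteBridgeP12

open Literature.MathematicalPhysics.QuantumFieldTheory.Balaban1983to89
open Literature.MathematicalPhysics.QuantumFieldTheory.Balaban1983to89.B5Prop11Plancherel (Tor fine)
open Literature.MathematicalPhysics.QuantumFieldTheory.Balaban1983to89.B5Block118 (bpt)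
open Literature.MathematicalPhysics.QuantumFieldTheory.Balaban1983to89.B5Blocks16 (bpt_val bpt_bijective blockOf_bpt)
open Literature.MathematicalPhysics.QuantumFieldTheory.Balaban1983to89.B5Prop12FieldsLattice (toFine cubeT cdistF distU distSite)
open Literature.MathematicalPhysics.QuantumFieldTheory.Balaban1983to89.B5RowSumsP12Lattice (chartSite tdist_chartSite)
open Literature.MathematicalPhysics.QuantumFieldTheory.Balaban1983to89.B5Ineq137Torus (Nv toT T fine_val blk blk_val distX)
open Literature.MathematicalPhysics.QuantumFieldTheory.Balaban1983to89.B5GpSettingTorus (inCube)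

noncomputable section

variable (P : Params)

/-! ## §1 The parameters and the two bijections -/

/-- **`n = L^K`**: fine steps (`ε = L^{−K}`) per unit on `T_ε` (Prop. 1.2 at the top level `k = K`, `η = ε`).
[cite: Balaban1984PropagatorsI, p.35 («ε = L^{−K}»)] -/
def nP : ℕ := P.L ^ P.K

/-- **`M_μ = 2L^m`**: unit cubes per direction of the tori `T^{(j)}` of `Setup` (all directions equal).
[cite: Balaban1984PropagatorsI, (1.6) p.18; Balaban1987RG1, (0.1) p.251] -/
def MP : Fin P.d → ℕ := fun _ => 2 * P.L ^ P.m

/-- `n ≠ 0`. [folklore] -/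
instance nP_neZero : NeZero (nP P) := ⟨(pow_pos P.L_pos _).ne'⟩

/-- `M_μ ≠ 0`. [folklore] -/
instance MP_neZero (μ : Fin P.d) : NeZero (MP P μ) := ⟨by unfold MP; have := P.L_pos; positivity⟩

/-- `1 ≤ n` (`L ≥ 1`). [cite: Balaban1984PropagatorsI, p.35 («ε = L^{−K}»)] -/
theorem one_le_nP : 1 ≤ nP P := pow_pos P.L_pos _

/-- **`2 ≤ M_μ`** (the hypothesis of `B5GlobCoverP12Lattice.globCoverP12`). [cite: Balaban1984PropagatorsI, (1.6) p.18] -/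
theorem two_le_MP (μ : Fin P.d) : 2 ≤ MP P μ := by
  unfold MP
  have := pow_pos P.L_pos P.m
  omega

/-- `sitesPerDir 0 = n·M_μ` (`2L^{m+K} = L^K·2L^m`). [cite: Balaban1987RG1, (0.1) p.251] -/
theorem sitesPerDir_zero_eq (μ : Fin P.d) : P.sitesPerDir 0 = fine (nP P) (MP P) μ := by
  simp only [Params.sitesPerDir, nP, MP, fine, Nat.sub_zero, pow_add]
  ring

/-- `sitesPerDir K = M_μ` (`2L^{m+K−K} = 2L^m`). [cite: Balaban1987RG1, (0.1) p.251] -/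
theorem sitesPerDir_K_eq (μ : Fin P.d) : P.sitesPerDir P.K = MP P μ := by
  simp only [Params.sitesPerDir, MP, Nat.add_sub_cancel]

/-- **the fine-torus bijection `Site P 0 ≃ Tor (fine n M)`** (coordinatewise `ZMod.ringEquivCongr`).
[cite: Balaban1984PropagatorsI, p.35 (T_η)] -/
def eFine : Site P 0 ≃ Tor (fine (nP P) (MP P)) where
  toFun x := fun μ => ZMod.ringEquivCongr (sitesPerDir_zero_eq P μ) (x μ)
  invFun t := fun μ => (ZMod.ringEquivCongr (sitesPerDir_zero_eq P μ)).symm (t μ)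
  left_inv x := by funext μ; exact (ZMod.ringEquivCongr _).symm_apply_apply (x μ)
  right_inv t := by funext μ; exact (ZMod.ringEquivCongr _).apply_symm_apply (t μ)

/-- **the unit-lattice bijection `Site P K ≃ Tor M`**. [cite: Balaban1984PropagatorsI, p.35 (T₁^{(k)})] -/
def eUnit : Site P P.K ≃ Tor (MP P) where
  toFun y := fun μ => ZMod.ringEquivCongr (sitesPerDir_K_eq P μ) (y μ)
  invFun t := fun μ => (ZMod.ringEquivCongr (sitesPerDir_K_eq P μ)).symm (t μ)
  left_inv y := by funext μ; exact (ZMod.ringEquivCongr _).symm_apply_apply (y μ)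
  right_inv t := by funext μ; exact (ZMod.ringEquivCongr _).apply_symm_apply (t μ)

/-- unfolding of `eFine`. [cite: Balaban1984PropagatorsI, p.35 (T_η)] -/
theorem eFine_apply (x : Site P 0) (μ : Fin P.d) : eFine P x μ = ZMod.ringEquivCongr (sitesPerDir_zero_eq P μ) (x μ) := rfl

/-- unfolding of `eUnit`. [cite: Balaban1984PropagatorsI, p.35 (T₁^{(k)})] -/
theorem eUnit_apply (y : Site P P.K) (μ : Fin P.d) : eUnit P y μ = ZMod.ringEquivCongr (sitesPerDir_K_eq P μ) (y μ) := rfl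

/-- **`eFine` preserves coordinates.** [cite: Balaban1984PropagatorsI, p.35 (T_η)] -/
@[simp] theorem eFine_val (x : Site P 0) (μ : Fin P.d) : (eFine P x μ).val = (x μ).val := ZMod.ringEquivCongr_val _ _

/-- **`eUnit` preserves coordinates.** [cite: Balaban1984PropagatorsI, p.35 (T₁^{(k)})] -/
@[simp] theorem eUnit_val (y : Site P P.K) (μ : Fin P.d) : (eUnit P y μ).val = (y μ).val := ZMod.ringEquivCongr_val _ _

/-- `eFine` is additive coordinatewise (differences of sites ↦ differences). [cite: Balaban1984PropagatorsI, p.35 (T_η)] -/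
theorem eFine_sub (x x' : Site P 0) (μ : Fin P.d) :
    eFine P x μ - eFine P x' μ = ZMod.ringEquivCongr (sitesPerDir_zero_eq P μ) (x μ - x' μ) := by
  rw [eFine_apply, eFine_apply, map_sub]

/-- `eUnit` is additive coordinatewise. [cite: Balaban1984PropagatorsI, p.35 (T₁^{(k)})] -/
theorem eUnit_sub (y y' : Site P P.K) (μ : Fin P.d) :
    eUnit P y μ - eUnit P y' μ = ZMod.ringEquivCongr (sitesPerDir_K_eq P μ) (y μ - y' μ) := by
  rw [eUnit_apply, eUnit_apply, map_sub]

/-! ## §2 Corner map and blocks -/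

/-- coordinates of `toFine`: `n·y_μ` (no wrap-around). [cite: Balaban1984PropagatorsI, (1.6) p.18] -/
theorem toFine_val {d : ℕ} (n : ℕ) [NeZero n] (M : Fin d → ℕ) [∀ μ, NeZero (M μ)] (y : Tor M) (μ : Fin d) :
    (toFine n M y μ).val = n * (y μ).val := by
  unfold toFine
  rw [Int.cast_natCast, ZMod.val_natCast]
  apply Nat.mod_eq_of_lt
  show n * (y μ).val < n * M μ
  exact Nat.mul_lt_mul_of_pos_left (ZMod.val_lt (y μ)) (Nat.pos_of_ne_zero (NeZero.ne n))

/-- **the corner map commutes with the bijections**: `eFine (L^K·y) = n·(eUnit y)`. [cite: Balaban1984PropagatorsI, (1.6) p.18] -/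
theorem eFine_fine (y : Site P P.K) : eFine P (B5Ineq137Torus.fine P P.K y) = toFine (nP P) (MP P) (eUnit P y) := by
  funext μ
  apply ZMod.val_injective
  rw [eFine_val, fine_val P (Nat.le_add_left P.K P.m) y μ, toFine_val, eUnit_val]
  rfl

/-- **blocks commute with the bijections**: `eUnit (blk_K p) = blockOf (eFine p)` (`⌊p_μ/L^K⌋` on both sides).
[cite: Balaban1984PropagatorsI, (1.6) p.18] -/
theorem eUnit_blk (p : Site P 0) : eUnit P (blk P P.K p) = B5Blocks16.blockOf (nP P) (MP P) (eFine P p) := by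
  -- write `eFine p = bpt y j`; then `blockOf (eFine p) = y` and `⌊val/n⌋ = val y`
  obtain ⟨⟨y, j⟩, hyj⟩ := (bpt_bijective (nP P) (MP P)).2 (eFine P p)
  have hblock : B5Blocks16.blockOf (nP P) (MP P) (eFine P p) = y := by
    rw [← hyj]; exact blockOf_bpt (nP P) (MP P) y j
  rw [hblock]
  funext μ
  apply ZMod.val_injective
  rw [eUnit_val, blk_val P (Nat.le_add_left P.K P.m) p μ]
  have hv : (p μ).val = nP P * (y μ).val + (j μ : ℕ) := by
    rw [← eFine_val P p μ, ← hyj]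
    exact bpt_val (nP P) (MP P) y j μ
  rw [hv]
  show (nP P * (y μ).val + (j μ : ℕ)) / P.L ^ P.K = (y μ).val
  have hn : 0 < nP P := one_le_nP P
  change (nP P * (y μ).val + (j μ : ℕ)) / nP P = (y μ).val
  rw [Nat.mul_add_div hn, Nat.div_eq_of_lt (j μ).isLt, Nat.add_zero]

/-! ## §3 Distances -/

/-- the two torus distances agree coordinatewise through `eFine`. [cite: Balaban1984PropagatorsI, p.35 (|y − y′|)] -/
theorem ccoord_eFine (x x' : Site P 0) (μ : Fin P.d) :
    B4Sect5Torus.ccoord (Nv P 0) (toT x) (toT x') μ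
      = B4Sect5Torus.ccoord (fine (nP P) (MP P)) (chartSite _ (eFine P x)) (chartSite _ (eFine P x')) μ := by
  show (B4TorusKernel.MultiPeriod.circAbs (P.sitesPerDir 0) (((x μ).val : ℤ) - ((x' μ).val : ℤ))).toNat
    = (B4TorusKernel.MultiPeriod.circAbs (nP P * MP P μ) (((eFine P x μ).val : ℤ) - ((eFine P x' μ).val : ℤ))).toNat
  rw [eFine_val, eFine_val, show nP P * MP P μ = P.sitesPerDir 0 from (sitesPerDir_zero_eq P μ).symm]

/-- **`T P 0 = distSite (fine n M)` through `eFine`** (the sup torus distance in fine steps).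
[cite: Balaban1984PropagatorsI, p.35 (|y − y′|)] -/
theorem T_zero_eq (x x' : Site P 0) : T P 0 x x' = distSite (fine (nP P) (MP P)) (eFine P x) (eFine P x') := by
  rw [← tdist_chartSite]
  unfold T B4Sect5Torus.tdist
  have hfun : B4Sect5Torus.ccoord (Nv P 0) (toT x) (toT x')
      = B4Sect5Torus.ccoord (fine (nP P) (MP P)) (chartSite _ (eFine P x)) (chartSite _ (eFine P x')) :=
    funext (ccoord_eFine P x x')
  rw [hfun]

/-- the distance in units of `n` fine steps is the fine sup distance divided by `n`. [cite: Balaban1984PropagatorsI, p.35] -/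
theorem distU_eq_distSite_div {d : ℕ} (n : ℕ) [NeZero n] (M : Fin d → ℕ) [∀ μ, NeZero (M μ)] (x x' : Tor (fine n M)) :
    distU n M x x' = distSite (fine n M) x x' / n := rfl

/-- **`T P 0 = n · distU` through `eFine`.** [cite: Balaban1984PropagatorsI, p.35 (|y − y′|)] -/
theorem T_zero_eq_mul_distU (x x' : Site P 0) : T P 0 x x' = nP P * distU (nP P) (MP P) (eFine P x) (eFine P x') := by
  rw [distU_eq_distSite_div, T_zero_eq]
  have hn : (nP P : ℝ) ≠ 0 := by exact_mod_cast (NeZero.ne (nP P))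
  field_simp

/-- the unit-lattice distances agree coordinatewise through `eUnit`. [cite: Balaban1984PropagatorsI, p.35 (|y − y′|)] -/
theorem ccoord_eUnit (y y' : Site P P.K) (μ : Fin P.d) :
    B4Sect5Torus.ccoord (Nv P P.K) (toT y) (toT y') μ
      = B4Sect5Torus.ccoord (MP P) (chartSite _ (eUnit P y)) (chartSite _ (eUnit P y')) μ := by
  show (B4TorusKernel.MultiPeriod.circAbs (P.sitesPerDir P.K) (((y μ).val : ℤ) - ((y' μ).val : ℤ))).toNat
    = (B4TorusKernel.MultiPeriod.circAbs (MP P μ) (((eUnit P y μ).val : ℤ) - ((eUnit P y' μ).val : ℤ))).toNat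
  rw [eUnit_val, eUnit_val, ← sitesPerDir_K_eq P μ]

/-- **`T P K = distSite M` through `eUnit`** (the printed `|y − y′|` on the unit lattice). [cite: Balaban1984PropagatorsI, p.35 (|y − y′|)] -/
theorem T_K_eq (y y' : Site P P.K) : T P P.K y y' = distSite (MP P) (eUnit P y) (eUnit P y') := by
  rw [← tdist_chartSite]
  unfold T B4Sect5Torus.tdist
  have hfun : B4Sect5Torus.ccoord (Nv P P.K) (toT y) (toT y')
      = B4Sect5Torus.ccoord (MP P) (chartSite _ (eUnit P y)) (chartSite _ (eUnit P y')) :=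
    funext (ccoord_eUnit P y y')
  rw [hfun]

/-- **`distX P K = distU` through `eFine`** (distances on `T_ε` in units of `L^Kε = 1`). [cite: Balaban1984PropagatorsI, (1.109) p.35] -/
theorem distX_K_eq (x x' : Site P 0) : distX P P.K x x' = distU (nP P) (MP P) (eFine P x) (eFine P x') := by
  unfold distX
  rw [T_zero_eq_mul_distU]
  have hL : ((P.L : ℝ) ^ P.K) = (nP P : ℝ) := by simp [nP]
  have hn : (nP P : ℝ) ≠ 0 := by exact_mod_cast (NeZero.ne (nP P))
  rw [hL]
  field_simp

/-! ## §4 Cubes -/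

/-- membership in `cubeT` is the coordinatewise condition. [cite: Balaban1984PropagatorsI, p.35 (Δ̃(y))] -/
theorem mem_cubeT_iff {d : ℕ} (n : ℕ) [NeZero n] (M : Fin d → ℕ) [∀ μ, NeZero (M μ)] (x : Tor (fine n M)) (y : Tor M) :
    x ∈ cubeT n M y ↔ ∀ μ, cdistF n M x (toFine n M y) μ ≤ n := by
  simp [cubeT]

/-- `distSite (fine n M) x x′ ≤ n ↔` every coordinate distance is `≤ n`. [cite: Balaban1984PropagatorsI, p.35 (Δ̃(y))] -/
theorem distSite_fine_le_iff {d : ℕ} (n : ℕ) [NeZero n] (M : Fin d → ℕ) [∀ μ, NeZero (M μ)] (x x' : Tor (fine n M)) :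
    distSite (fine n M) x x' ≤ n ↔ ∀ μ, cdistF n M x x' μ ≤ n := by
  unfold distSite
  rw [Nat.cast_le, Finset.sup_le_iff]
  simp [cdistF]

/-- **the cubes agree: `x ∈ Δ̃(y)` in the tower ↔ `eFine x ∈ cubeT (eUnit y)`**. [cite: Balaban1984PropagatorsI, p.35 (Δ̃(y))] -/
theorem inCube_K_iff (x : Site P 0) (y : Site P P.K) :
    inCube P P.K x y ↔ eFine P x ∈ cubeT (nP P) (MP P) (eUnit P y) := by
  rw [mem_cubeT_iff, ← distSite_fine_le_iff, inCube, T_zero_eq, eFine_fine]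
  have hL : ((P.L : ℝ) ^ P.K) = (nP P : ℝ) := by simp [nP]
  rw [hL]

end

end Literature.MathematicalPhysics.QuantumFieldTheory.Balaban1983to89.B5SiteBridgeP12
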